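import Summits.AtomisticToContinuum.BoseEinsteinCondensation.Theses.BECHeatBathGap
import Summits.AtomisticToContinuum.BoseEinsteinCondensation.Theorems.BECHeatBathGapWitnessToBEC
import Summits.AtomisticToContinuum.BoseEinsteinCondensation.Theorems.BECHeatBathGapNearMinimiserStability
import Literature.MathematicalPhysics.QuantumManyBody.JelliumBoseGasProofs
import Literature.MathematicalPhysics.QuantumManyBody.BoseGasDirichletWall
import Literature.MathematicalPhysics.QuantumManyBody.BoseGasFreeDirichletBEC
import HarnessLib

/-!
# Route `BECHeatBathGap`, support item `SomeNearMinimiserCondenses` (stmt-AtomisticToContinuum-14369):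
# status of the standalone statement — it is the conjunct, modulo fixed-`N` rigidity

`SomeNearMinimiserCondenses` says: for every repulsive finite-range `v` there is `ρ₀ > 0` such that
for `0 < ρ < ρ₀` there is `c > 0` with, for all large `N` and EVERY slack `δ > 0`, SOME
`δ`-near-minimiser `Ψ` of the `(N+1)`-body Dirichlet energy in the box of side `((N+1)/ρ)^{1/3}`
having `λ_max(γ_Ψ) = maxOccupation ≥ c (N+1)`.

Inside the route it is the typed junction reached from the cruxes by
`someNearMinimiserCondenses_of_tensorisation : ParticleTensorisation → SquareSummableInfluence →
SomeNearMinimiserCondenses` (file `BECHeatBathGapSomeNearMinimiserCondenses`). This file settles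
what the statement is ON ITS OWN, in both directions:

* `someNearMinimiserCondenses_of_boseEinsteinCondensation :
    BoseEinsteinCondensation → SomeNearMinimiserCondenses` — the sub-problem Statement (the open
  conjunct) implies the item outright: `condensateNumber ≥ c N` is a `sup` over slacks of an `inf`
  over near-minimisers, so below `c N` some slack `δ'` has ALL its near-minimisers condensing, and a
  `min δ δ'`-near-minimiser exists at every `δ > 0` (`iInf_lt_iff` when `E₀ < ⊤`, any trial state
  when `E₀ = ⊤`); the index shift `N ↦ N + 1` is `tendsto_add_atTop_nat`;
* `boseEinsteinCondensation_of_someNearMinimiserCondenses :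
    SomeNearMinimiserCondenses → GroundStateRigidity → BoseEinsteinCondensation` — the route's own
  frame (`witnessToBEC_proof` with the landed `becHeatBathGap_nearMinimiserStability_proof`);
* hence `someNearMinimiserCondenses_iff_boseEinsteinCondensation :
    GroundStateRigidity → (SomeNearMinimiserCondenses ↔ BoseEinsteinCondensation)`.

So, granted the shared fixed-`N` rigidity crux (stmt-AtomisticToContinuum-9072), the item is
EQUIVALENT to Bose–Einstein condensation for the dilute interacting gas [LSSY2005, §1.2 and Ch. 5:
open]; it is correctly stated (not vacuous, not refutable short of refuting the conjunct) and has no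
unconditional proof short of the conjunct itself — it closes exactly when the cruxes
`ParticleTensorisation` (stmt-14367) and `SquareSummableInfluence` (stmt-14368) do, through
`someNearMinimiserCondenses_of_tensorisation`. As a typing check the `v = 0` corner of its body
holds at every density (`someNearMinimiserCondenses_body_zero`, from the Literature theorem
`hasGroundStateBEC_zero` for the free Dirichlet gas).
-/

noncomputable section

open MeasureTheory Filter
open scoped ENNReal

namespace Summit.AtomisticToContinuum.BoseEinsteinCondensation.Theorems

open Literature.MathematicalPhysics.QuantumManyBody.BoseGas

/-- **From a condensate-number lower bound to a condensing near-minimiser at every slack.**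
If `m < condensateNumber v N L` (`N ≥ 1`, `L > 0`), then for every `δ > 0` some `δ`-near-minimiser
`Ψ` of the `N`-body Dirichlet energy has `m ≤ λ_max(γ_Ψ)`: `condensateNumber` is
`sup_{δ' > 0} inf_{δ'-near-minimisers} λ_max`, so some `δ' > 0` has its whole infimum above `m`, and a
`min δ δ'`-near-minimiser exists (by `iInf_lt_iff` if `E₀ < ⊤`; any trial state if `E₀ = ⊤`, the
class being inhabited by `TrialState.nonempty`). [cite: LSSY2005, §1.2 (1.17)–(1.19)] -/
theorem exists_nearMinimiser_le_maxOccupation_of_lt_condensateNumber {v : ℝ → ℝ≥0∞} {N : ℕ}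
    {L : ℝ} (hN : 0 < N) (hL : 0 < L) {m : ℝ≥0∞} (hm : m < condensateNumber v N L) {δ : ℝ≥0∞}
    (hδ : 0 < δ) :
    ∃ Ψ : TrialState N L, energy v Ψ ≤ groundStateEnergy v N L + δ ∧ m ≤ maxOccupation N Ψ.ψ := by
  unfold condensateNumber at hm
  rw [lt_iSup_iff] at hm
  obtain ⟨δ', hδ'⟩ := hm
  rw [lt_iSup_iff] at hδ'
  obtain ⟨hδ'pos, hlt⟩ := hδ'
  -- a `min δ δ'`-near-minimiser exists
  obtain ⟨Ψ, hΨ⟩ : ∃ Ψ : TrialState N L, energy v Ψ ≤ groundStateEnergy v N L + min δ δ' := by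
    rcases eq_or_ne (groundStateEnergy v N L) ⊤ with htop | htop
    · obtain ⟨Ψ⟩ := TrialState.nonempty hN hL
      exact ⟨Ψ, by rw [htop, top_add]; exact le_top⟩
    · have h : groundStateEnergy v N L < groundStateEnergy v N L + min δ δ' :=
        ENNReal.lt_add_right htop (lt_min hδ hδ'pos).ne'
      obtain ⟨Ψ, hΨ⟩ := iInf_lt_iff.1 h
      exact ⟨Ψ, hΨ.le⟩
  exact ⟨Ψ, hΨ.trans (add_le_add le_rfl (min_le_left _ _)),
    hlt.le.trans (iInf₂_le Ψ (hΨ.trans (add_le_add le_rfl (min_le_right _ _))))⟩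

/-- **Ground-state BEC at density `ρ` gives condensing near-minimisers at every slack**, in the
route's indexing: if `HasGroundStateBEC v ρ` (`λ_max(γ_{Ψ₀}) ≥ c N` for all large `N`, with
`L = (N/ρ)^{1/3}`), then with constant `c / 2`, for all large `N` and every `δ > 0` some
`δ`-near-minimiser of the `(N+1)`-body energy in the box of side `((N+1)/ρ)^{1/3}` has
`maxOccupation ≥ (c/2)(N+1)` (index shift `N ↦ N + 1` by `tendsto_add_atTop_nat`, then
`exists_nearMinimiser_le_maxOccupation_of_lt_condensateNumber`). [cite: LSSY2005, §1.2 (1.19)] -/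
theorem eventually_exists_nearMinimiser_of_hasGroundStateBEC {v : ℝ → ℝ≥0∞} {ρ : ℝ} (hρ : 0 < ρ)
    (h : HasGroundStateBEC v ρ) :
    ∃ c : ℝ, 0 < c ∧ ∀ᶠ N : ℕ in atTop, ∀ δ : ℝ≥0∞, 0 < δ →
      ∃ Ψ : TrialState (N + 1) (sideLength ρ (N + 1)),
        energy v Ψ ≤ groundStateEnergy v (N + 1) (sideLength ρ (N + 1)) + δ ∧
          ENNReal.ofReal (c * (N + 1)) ≤ maxOccupation (N + 1) Ψ.ψ := by
  obtain ⟨c, hc, hN⟩ := h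
  refine ⟨c / 2, half_pos hc, ?_⟩
  filter_upwards [(tendsto_add_atTop_nat 1).eventually hN] with N hN1
  intro δ hδ
  have hL : 0 < sideLength ρ (N + 1) := sideLength_pos_of_pos hρ (Nat.succ_pos N)
  have hpos : (0 : ℝ) < c * ((N + 1 : ℕ) : ℝ) := by positivity
  have hlt : ENNReal.ofReal (c / 2 * ((N : ℝ) + 1)) <
      condensateNumber v (N + 1) (sideLength ρ (N + 1)) := by
    refine lt_of_lt_of_le ?_ hN1
    rw [ENNReal.ofReal_lt_ofReal_iff hpos]
    push_cast
    nlinarith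
  exact exists_nearMinimiser_le_maxOccupation_of_lt_condensateNumber (Nat.succ_pos N) hL hlt hδ

/-- **The conjunct implies the item**: `BoseEinsteinCondensation → SomeNearMinimiserCondenses`
(same threshold `ρ₀`, constant halved), by `eventually_exists_nearMinimiser_of_hasGroundStateBEC`
at each admissible density. In particular an unconditional proof of the support item
stmt-AtomisticToContinuum-14369 is at least as hard as the sub-problem Statement (open).
[cite: LSSY2005, §1.2 and Ch. 5 p. 42] -/
theorem someNearMinimiserCondenses_of_boseEinsteinCondensation (h : _root_.BoseEinsteinCondensation) :
    Summit.AtomisticToContinuum.BoseEinsteinCondensation.Theses.BECHeatBathGap.SomeNearMinimiserCondenses := by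
  unfold Summit.AtomisticToContinuum.BoseEinsteinCondensation.Theses.BECHeatBathGap.SomeNearMinimiserCondenses
  intro v hv
  obtain ⟨ρ₀, hρ₀, H⟩ := h v hv
  exact ⟨ρ₀, hρ₀, fun ρ hρ hρlt =>
    eventually_exists_nearMinimiser_of_hasGroundStateBEC hρ (H ρ hρ hρlt)⟩

/-- **The item implies the conjunct, given fixed-`N` rigidity** — the route's frame:
`SomeNearMinimiserCondenses → GroundStateRigidity → BoseEinsteinCondensation`, i.e.
`witnessToBEC_proof` (stmt-14372) fed with the landed `becHeatBathGap_nearMinimiserStability_proof`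
(stmt-14371). [cite: LSSY2005, §1.2 (1.19)] -/
theorem boseEinsteinCondensation_of_someNearMinimiserCondenses
    (hS : Summit.AtomisticToContinuum.BoseEinsteinCondensation.Theses.BECHeatBathGap.SomeNearMinimiserCondenses)
    (hR : Summit.AtomisticToContinuum.BoseEinsteinCondensation.Theses.BECHeatBathGap.GroundStateRigidity) :
    _root_.BoseEinsteinCondensation :=
  witnessToBEC_proof hS becHeatBathGap_nearMinimiserStability_proof hR

/-- **Status of stmt-AtomisticToContinuum-14369.** Granted the shared fixed-`N` rigidity crux
`GroundStateRigidity` (stmt-AtomisticToContinuum-9072), the support item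
`SomeNearMinimiserCondenses` is EQUIVALENT to the sub-problem Statement `BoseEinsteinCondensation`
(BEC for the dilute interacting Bose gas, open [LSSY2005, Ch. 5]): it is correctly stated and has
no proof short of the conjunct; inside the route it closes exactly when the cruxes
`ParticleTensorisation` and `SquareSummableInfluence` do (`someNearMinimiserCondenses_of_tensorisation`).
[cite: LSSY2005, §1.2 and Ch. 5 p. 42] -/
theorem someNearMinimiserCondenses_iff_boseEinsteinCondensation
    (hR : Summit.AtomisticToContinuum.BoseEinsteinCondensation.Theses.BECHeatBathGap.GroundStateRigidity) :
    Summit.AtomisticToContinuum.BoseEinsteinCondensation.Theses.BECHeatBathGap.SomeNearMinimiserCondenses ↔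
      _root_.BoseEinsteinCondensation :=
  ⟨fun hS => boseEinsteinCondensation_of_someNearMinimiserCondenses hS hR,
    someNearMinimiserCondenses_of_boseEinsteinCondensation⟩

/-- **The free corner of the item holds at every density** (typing check): for `v = 0` and every
`ρ > 0` there is `c > 0` such that for all large `N` and every `δ > 0` some `δ`-near-minimiser of the
free `(N+1)`-body Dirichlet energy in the box of side `((N+1)/ρ)^{1/3}` has
`maxOccupation ≥ c (N+1)` — from the Literature theorem `hasGroundStateBEC_zero` (the free Dirichlet
gas condenses at every density) through `eventually_exists_nearMinimiser_of_hasGroundStateBEC`.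
[cite: LSSY2005, §1.2] -/
theorem someNearMinimiserCondenses_body_zero {ρ : ℝ} (hρ : 0 < ρ) :
    ∃ c : ℝ, 0 < c ∧ ∀ᶠ N : ℕ in atTop, ∀ δ : ℝ≥0∞, 0 < δ →
      ∃ Ψ : TrialState (N + 1) (sideLength ρ (N + 1)),
        energy 0 Ψ ≤ groundStateEnergy 0 (N + 1) (sideLength ρ (N + 1)) + δ ∧
          ENNReal.ofReal (c * (N + 1)) ≤ maxOccupation (N + 1) Ψ.ψ :=
  eventually_exists_nearMinimiser_of_hasGroundStateBEC hρ (hasGroundStateBEC_zero hρ)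

end Summit.AtomisticToContinuum.BoseEinsteinCondensation.Theorems

end
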